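import Literature.NumberTheory.LFunctions.CubeRootTwoField
import Literature.NumberTheory.Sieve.HeathBrownCubicPrimesOutlineProofs
import Mathlib.RingTheory.Norm.Basic
import Mathlib.LinearAlgebra.Matrix.Determinant.Basic
import HarnessLib

/-!
# Heath-Brown's sieve set-up over `K = ℚ(2^{1/3})` for primes `x³ + 2y³` (§3, pp. 10–13)

Fourth layer of the decomposition of **parity.S18**
(`Literature.NumberTheory.Sieve.setOf_prime_cube_add_two_mul_cube_infinite`) along Heath-Brown, *Primes represented
by `x³ + 2y³`*, Acta Math. 186 (2001). The layers above (`HeathBrownCubicPrimes`, `…Outline`,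
`…Proofs`, `…OutlineProofs`) reduce S18 to two named facts, Landau's prime ideal theorem and the
sieve comparison (2.4) `π(𝒜) = κπ(ℬ)(1 + o(1))`. The comparison (2.4) is the content of §§3–13; its
proof "performs identical sieve operations on the two sequences" `𝒜` and `ℬ`, working "over the
field `K = ℚ(2^{1/3})`" (p. 10). This file sets up that sieve — the objects in terms of which the
lemmas of §3 (Type I bounds 3.2/3.3, Buchstab decomposition (3.1)–(3.2), Lemmas 3.4–3.10) are
stated — and PROVES the elementary identities of pp. 10–13; the two Type I bounds are vendored as
named facts.

## Content (namespace `Literature.CubicSieve`; `K`, `θ = 2^{1/3}`, `θint ∈ 𝓞_K` from `CubeRootTwoField`)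

PROVED:
* `norm_add_mul_θint`, `absNorm_span_add_mul_θint`, `absNorm_pairIdeal` — **the norm form**
  `N(x + y·2^{1/3}) = x³ + 2y³` on `𝓞_K = ℤ[2^{1/3}]` (determinant of multiplication by `x + yθ`
  on `1, θ, θ²`), so the members `(x + yθ)` of `𝒜^(K)` have norms the members `x³ + 2y³` of `𝒜`.
* the objects of p. 10–11: `boxPairs`/`pairIdeal` (`𝒜^(K) = {(x + y·2^{1/3}) : x, y ∈ (X, X(1+η)],
  (x, y) = 1}`, a family indexed by the pairs), `normWindow` (`ℬ^(K) = {J : N(J) ∈ (3X³, 3X³(1+η)]}`),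
  `IsRough z I` (`P ∣ I → N(P) ≥ z`), `APairs`/`BIdeals` (`𝒵_R = {I ∈ 𝒵 : R ∣ I}`),
  `siftedA`/`siftedB` (`S_K(𝒵_R, z) = #{I ∈ 𝒵_R : P ∣ I → N(P) ≥ z}`), `countA`/`countB` (`#𝒵_R`).
* `isPrime_of_isRough` — a `z`-rough nonzero proper ideal of norm `< z²` is prime; hence
  **`primePairCount_eq_siftedA`: `π(𝒜) = S_K(𝒜^(K), 2X^{3/2})`** (p. 11; for `X ≥ 1`,
  `0 ≤ η ≤ 1/10`, using Lemma 3.1 for "`(x + y·2^{1/3})` prime ⇒ `x³ + 2y³` prime"), and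
  **`siftedB_one_eq_normPrimeCount_add`, `card_normWindow_isPrime_not_prime_le`:
  `S_K(ℬ^(K), 2X^{3/2}) = π(ℬ) + #{P : N(P) ∈ window, N(P) not prime}`, the correction being
  `≤ 3(√(3X³(1+η)) + 1)`** (p. 13: "`π(ℬ) = S_K(ℬ^(K), 2X^{3/2}) + O(X²)`"); here
  `π(ℬ) = ∑_{p ∈ window} ν_p` (`normPrimeCount`) via `card_absNorm_eq_prime_eq_cubeRootTwoCount`
  (`ν_p = #{I : N(I) = p}` for every prime `p`, Dedekind's theorem, p. 21).
* **`buchstab_identity`** — Buchstab's identity over `K` for a finite family of nonzero ideals none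
  of which has two distinct prime factors of equal norm:
  `S(𝒵, z₁) = S(𝒵, z₂) + ∑_{z₁ ≤ N(P) < z₂} S(𝒵_P, N(P))`; **`siftedA_buchstab`** — the exact
  identity for `𝒜^(K)_R` (the hypothesis is Lemma 3.1: "the various prime ideals `P_i` which occur
  when Buchstab's identity is applied must have distinct norms", p. 12), and
  `card_filter_dvd_isRough_eq_siftedA` (`P ∤ R ⇒` the summand is `S_K(𝒜^(K)_{RP}, N(P))`, the form
  iterated in (3.1)).
* **`pairIdeal_injOn`** — the members of `𝒜^(K)` are pairwise distinct ideals (p. 10: "if `η` is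
  small enough, no two values of `x + y·2^{1/3}` are associates"; proved for all `X ≥ 1`, `η ≤ 1`,
  from `𝓞_K = ℤ[θ]`: `exists_int_coords`, `intCoords_eq_zero`).

NAMED FACTS (`def … : Prop`, the Type I inputs of the sieve; proofs are §5 of the paper):
* `HeathBrown2001_typeI_A` — **Lemma 3.2**, level of distribution `X^{2−ε}` for `𝒜^(K)`:
  `∑_{Q<N(R)≤2Q, N(R) squarefree} τ(R)^A |#𝒜^(K)_R − (6η²X²/π²)ρ₂(R)/N(R)| ≪_A (Q + XQ^{1/2} + X^{3/2})(log QX)^{c(A)}`,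
  with `ρ₂(R) = ∏_{P ∣ R}(1 + N(P)^{-1})^{-1}` (`rho₂`) and `τ(R)` the number of ideal divisors
  (`idealDivisorCount`).
* `HeathBrown2001_typeI_B` — **Lemma 3.3**, level `X^{3−ε}` for `ℬ^(K)`:
  `∑_{Q<N(R)≤2Q} τ(R)^A |#ℬ^(K)_R − 3γ₀ηX³/N(R)| ≪_A X²Q^{1/3}(log Q)^{c(A)}`, `γ₀` the residue of
  `ζ_K` at `1` (`gamma₀ := NumberField.dedekindZeta_residue K`, p. 6).

## Faithfulness / modelling notes

* `𝒜^(K)` is modelled as the family `pairIdeal : ℕ × ℕ → Ideal (𝓞 K)` on the index set `boxPairs X η`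
  rather than as a set of ideals; the sifting functions count indices. By `pairIdeal_injOn` the
  family is injective, so this agrees with the paper's set, and it is the reading under which
  `π(𝒜)` (which counts representations, p. 4) equals `S_K(𝒜^(K), 2X^{3/2})` verbatim.
* "`P ∣ I`" for ideals is divisibility in the monoid of ideals (`= (I ≤ P)` in a Dedekind domain);
  "prime ideal" in the sums means nonzero prime (`primesNormIco` excludes `⊥`); `IsRough` quantifies
  over all prime `P ∣ I`, which for `I ≠ 0` are nonzero automatically.
* `π(𝒜) = S_K(𝒜^(K), 2X^{3/2})` needs the norms of `𝒜` to lie below `(2X^{3/2})² = 4X³`, i.e. `η`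
  small (`3(1+η)³ < 4`); the paper has `η = (log X)^{−c} → 0` and uses the identity without
  comment. We state it for `0 ≤ η ≤ 1/10` (our constant). Likewise the `ℬ`-side statements take
  `η < 1/3` (`3X³(1+η) < 4X³`).
* Buchstab's identity over `K` is exact only when least-norm prime factors are unique. For `𝒜^(K)`
  this is Lemma 3.1; for `ℬ^(K)` it fails ("the various prime ideals `P_i` that arise need not have
  distinct norms, although the ideals themselves must be distinct", p. 13), so the decomposition of
  `S_K(ℬ^(K), ·)` "in the obvious notation" (p. 13) requires a tie-breaking convention; that, and
  the pieces `S_j`, `T^(n)`, `U^(n)` of (3.1)–(3.2) with Lemmas 3.4–3.10, are left to the next layer.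
* Lemmas 3.2/3.3 are printed with `≪` and "for any positive integer `A` there exists a
  corresponding `c(A)`", implied constants depending on `A` only (p. 6); we render them with
  explicit constants `c, C` depending on `A`, uniformly for `X ≥ 2`, `η` in the standing range (2.1)
  `exp(−(log X)^{1/3}) ≤ η ≤ 1`, and `Q ≥ 1` (resp. `Q ≥ 2` in 3.3, where the bound carries
  `(log Q)^{c(A)}`); `R ∈ 𝒯r` is `Squarefree (N R)`. Lemmas 2.1/2.2 (the versions over `ℤ`, deduced
  from 3.2/3.3 on pp. 32–33) are not vendored here.

## References

* D. R. Heath-Brown, *Primes represented by `x³ + 2y³`*, Acta Math. 186 (2001), 1–84: §3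
  pp. 10–13 (the objects, Lemma 3.1's use, Buchstab's identity, `π(𝒜) = S_K(𝒜^(K), 2X^{3/2})`,
  `π(ℬ) = S_K(ℬ^(K), 2X^{3/2}) + O(X²)`), Lemmas 3.2, 3.3 (p. 11; proofs §5, pp. 28–32), p. 6 (`γ₀`).
  [cite: HeathBrownActa2001, §3 pp. 10–13]

## Mathlib / tree search

Mathlib: no sieve over number fields, no Buchstab identity (searched `Buchstab`, `rough`,
`sifted`); used `Ideal.finite_setOf_absNorm_le`, `Ideal.isPrime_of_irreducible_absNorm`,
`Ideal.absNorm_dvd_absNorm_of_le`, `Ideal.dvd_iff_le`, `Ideal.exists_le_maximal`,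
`Ideal.isCoprime_iff_sup_eq`, `IsCoprime.mul_dvd`, `Finset.card_biUnion`, `Finset.exists_min_image`,
`Algebra.norm_eq_matrix_det`, `Algebra.coe_norm_int`, `AdjoinRoot.powerBasis'`, `AdjoinRoot.mk_eq_zero`,
`Polynomial.eq_zero_of_dvd_of_degree_lt`, `aeval_modByMonic_eq_self_of_root`,
`NumberField.dedekindZeta_residue`. Tree: `CubeRootTwoField` (`K`, `θint`, `𝓞_K = ℤ[θ]`,
Lemma 3.1: `prime_absNorm_of_mem`, `eq_of_mem_of_absNorm_eq`; `card_absNorm_eq_prime`),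
`HeathBrownCubicPrimes` (`primePairs`, `cubeRootTwoCount`), `HeathBrownCubicPrimesOutline`
(`normPrimeCount`), `HeathBrownCubicPrimesOutlineProofs.card_filter_not_prime_absNorm_le`,
`PrimeIdealTheorem.primeIdealsLE`, `BatemanHornProofs.polyRootCountMod_single`.
-/

noncomputable section

open Polynomial NumberField Finset Filter Topology

namespace Literature.NumberTheory.Sieve.CubicSieve

open LFunctions.CubeRootTwoField CubicPrimes

/-! ### The norm form `N(x + y·2^{1/3}) = x³ + 2y³` -/

/-- `X³ − 2 ∈ ℚ[X]` is monic. [folklore] -/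
theorem cubicPolyRat_monic : cubicPolyRat.Monic := cubicPoly_monic.map _

/-- `deg (X³ − 2) = 3` over `ℚ`. [folklore] -/
theorem cubicPolyRat_natDegree : cubicPolyRat.natDegree = 3 := by
  rw [cubicPolyRat_eq, natDegree_X_pow_sub_C]

/-- `deg (X³ − 2) = 3` over `ℚ` (as a `WithBot ℕ` degree). [folklore] -/
theorem cubicPolyRat_degree : cubicPolyRat.degree = 3 := by
  rw [degree_eq_natDegree cubicPolyRat_ne_zero, cubicPolyRat_natDegree]; rfl

/-- The power basis `1, θ, θ²` of `ℚ[X]/(X³ − 2)` in Mathlib's `powerBasis'` form (coordinates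
are coefficients of remainders modulo `X³ − 2`). [folklore] -/
abbrev pbX : PowerBasis ℚ K := AdjoinRoot.powerBasis' cubicPolyRat_monic

/-- `pbX` has dimension `3`. [folklore] -/
theorem pbX_dim : pbX.dim = 3 := cubicPolyRat_natDegree

/-- Coordinates in `pbX`: the class of `p` has as coordinates the coefficients of
`p mod (X³ − 2)`. [folklore] -/
theorem repr_mk (p : ℚ[X]) (i : Fin pbX.dim) :
    pbX.basis.repr (AdjoinRoot.mk cubicPolyRat p) i = (p %ₘ cubicPolyRat).coeff i := by
  change (AdjoinRoot.powerBasisAux' cubicPolyRat_monic).repr _ i = _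
  rw [AdjoinRoot.powerBasisAux'_repr_apply_to_fun, AdjoinRoot.modByMonicHom_mk]

/-- Entries of the matrix of multiplication by the class of `p` on `1, θ, θ²`: the `(i, j)` entry
is the `i`-th coefficient of `p·X^j mod (X³ − 2)`. [folklore] -/
theorem leftMulMatrix_mk (p : ℚ[X]) (i j : Fin pbX.dim) :
    Algebra.leftMulMatrix pbX.basis (AdjoinRoot.mk cubicPolyRat p) i j =
      ((p * X ^ (j : ℕ)) %ₘ cubicPolyRat).coeff i := by
  rw [Algebra.leftMulMatrix_eq_repr_mul, PowerBasis.basis_eq_pow,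
    show pbX.gen = AdjoinRoot.mk cubicPolyRat X from (AdjoinRoot.mk_X).symm, ← map_pow, ← map_mul,
    repr_mk]

/-- Reduction of a polynomial modulo `X³ − 2` to an explicit quadratic remainder. [folklore] -/
theorem modByMonic_cubicPolyRat_eq {q : ℚ[X]} (a b c k : ℚ)
    (h : q - (C a * X ^ 2 + C b * X + C c) = cubicPolyRat * C k) :
    q %ₘ cubicPolyRat = C a * X ^ 2 + C b * X + C c := by
  rw [modByMonic_eq_of_dvd_sub cubicPolyRat_monic (Dvd.intro _ h.symm),
    modByMonic_eq_self_iff cubicPolyRat_monic, cubicPolyRat_degree]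
  exact degree_quadratic_le.trans_lt (by decide)

/-- **The norm form on `𝓞_K = ℤ[2^{1/3}]`**: `N(x + y·2^{1/3}) = x³ + 2y³` for `x, y ∈ ℤ`,
computed as the determinant `|x 0 2y; y x 0; 0 y x|` of multiplication by `x + yθ` on the basis
`1, θ, θ²` of `K/ℚ`. [folklore] -/
theorem norm_add_mul_θint (x y : ℤ) :
    Algebra.norm ℤ ((x : 𝓞 K) + (y : 𝓞 K) * θint) = x ^ 3 + 2 * y ^ 3 := by
  classical
  set p : ℚ[X] := C (y : ℚ) * X + C (x : ℚ) with hp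
  -- the three columns `p X^j mod (X³ − 2)`, `j = 0, 1, 2`
  have r0 : p %ₘ cubicPolyRat = C 0 * X ^ 2 + C (y : ℚ) * X + C (x : ℚ) :=
    modByMonic_cubicPolyRat_eq 0 y x 0 (by rw [hp, cubicPolyRat_eq]; simp)
  have r1 : (p * X) %ₘ cubicPolyRat = C (y : ℚ) * X ^ 2 + C (x : ℚ) * X + C 0 :=
    modByMonic_cubicPolyRat_eq y x 0 0 (by rw [hp, cubicPolyRat_eq]; simp; ring)
  have r2 : (p * X ^ 2) %ₘ cubicPolyRat = C (x : ℚ) * X ^ 2 + C 0 * X + C (2 * (y : ℚ)) :=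
    modByMonic_cubicPolyRat_eq x 0 (2 * y) y (by rw [hp, cubicPolyRat_eq]; simp; ring)
  -- the matrix of multiplication by `p` on the basis reindexed by `Fin 3`
  set e := finCongr pbX_dim with he
  have hv : ∀ j : Fin 3, ((e.symm j : Fin pbX.dim) : ℕ) = (j : ℕ) := fun j => rfl
  have hent : ∀ i j : Fin 3,
      Algebra.leftMulMatrix (pbX.basis.reindex e) (AdjoinRoot.mk cubicPolyRat p) i j =
        ((p * X ^ (j : ℕ)) %ₘ cubicPolyRat).coeff (i : ℕ) := by
    intro i j
    rw [Algebra.leftMulMatrix_eq_repr_mul, Module.Basis.reindex_apply,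
      Module.Basis.repr_reindex_apply, ← Algebra.leftMulMatrix_eq_repr_mul, leftMulMatrix_mk,
      hv, hv]
  have hdet := Algebra.norm_eq_matrix_det (pbX.basis.reindex e) (AdjoinRoot.mk cubicPolyRat p)
  rw [Matrix.det_fin_three] at hdet
  simp only [hent, Fin.val_zero, Fin.val_one, Fin.val_two, pow_zero, mul_one, pow_one, r0, r1,
    r2, coeff_add, coeff_C_mul, coeff_X_pow, coeff_X, coeff_C] at hdet
  norm_num at hdet
  -- transfer to `𝓞_K` (`Algebra.coe_norm_int`); the two `ℚ`-algebra structures on `K` agree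
  have h := Algebra.coe_norm_int ((x : 𝓞 K) + (y : 𝓞 K) * θint)
  have hK : (((x : 𝓞 K) + (y : 𝓞 K) * θint : 𝓞 K) : K) = AdjoinRoot.mk cubicPolyRat p := by
    rw [hp, map_add, map_mul, AdjoinRoot.mk_C, AdjoinRoot.mk_C, AdjoinRoot.mk_X, map_intCast,
      map_intCast, RingOfIntegers.coe_eq_algebraMap, map_add, map_mul, map_intCast, map_intCast,
      show algebraMap (𝓞 K) K θint = θ from rfl, show AdjoinRoot.root cubicPolyRat = θ from rfl]
    ring
  rw [hK] at h
  suffices hq : ((Algebra.norm ℤ ((x : 𝓞 K) + (y : 𝓞 K) * θint) : ℤ) : ℚ) =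
      (x : ℚ) ^ 3 + 2 * (y : ℚ) ^ 3 by exact_mod_cast hq
  rw [h]
  convert hdet using 2 <;> ring

/-- `N((x + y·2^{1/3})) = |x³ + 2y³|` for the principal ideal. [folklore] -/
theorem absNorm_span_add_mul_θint (x y : ℤ) :
    Ideal.absNorm (Ideal.span {((x : 𝓞 K) + (y : 𝓞 K) * θint : 𝓞 K)}) =
      (x ^ 3 + 2 * y ^ 3).natAbs := by
  rw [Ideal.absNorm_span_singleton, norm_add_mul_θint]


/-! ### `𝒜^(K)`, `ℬ^(K)`, rough ideals and the sifting functions `S_K` (pp. 10–11) -/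

/-- The index set of `𝒜^(K)`: pairs of natural numbers `x, y ∈ (X, X(1+η)]` with `(x, y) = 1`
(the bounding box `[0, ⌊X(1+η)⌋₊]²` loses no such pair, `mem_boxPairs_iff`). Heath-Brown's
`𝒜^(K) = {(x + y·2^{1/3}) : x, y ∈ (X, X(1+η)] ∩ ℕ, (x, y) = 1}` (p. 10) is the family of ideals
`pairIdeal` indexed by this set (a family rather than a set of ideals: the paper observes that its
members are distinct, which we also prove, `pairIdeal_injOn`, but the sifting functions below count
indices, i.e. representations, exactly as `π(𝒜)` does). [cite: HeathBrownActa2001, §3 p. 10] -/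
def boxPairs (X η : ℝ) : Finset (ℕ × ℕ) :=
  {xy ∈ Iic ⌊X * (1 + η)⌋₊ ×ˢ Iic ⌊X * (1 + η)⌋₊ |
      X < xy.1 ∧ (xy.1 : ℝ) ≤ X * (1 + η) ∧ X < xy.2 ∧ (xy.2 : ℝ) ≤ X * (1 + η) ∧
      Nat.Coprime xy.1 xy.2}

/-- Membership in `boxPairs`: the bounding box is redundant. [cite: HeathBrownActa2001, §3 p. 10] -/
theorem mem_boxPairs_iff {X η : ℝ} {xy : ℕ × ℕ} :
    xy ∈ boxPairs X η ↔
      X < xy.1 ∧ (xy.1 : ℝ) ≤ X * (1 + η) ∧ X < xy.2 ∧ (xy.2 : ℝ) ≤ X * (1 + η) ∧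
        Nat.Coprime xy.1 xy.2 := by
  simp only [boxPairs, mem_filter, mem_product, mem_Iic, and_iff_right_iff_imp]
  rintro ⟨-, hx, -, hy, -⟩
  exact ⟨Nat.le_floor hx, Nat.le_floor hy⟩

/-- Heath-Brown's `π`-pairs are the box pairs with `x³ + 2y³` prime. [cite: HeathBrownActa2001, §2 (2.2)] -/
theorem primePairs_eq_filter (X η : ℝ) :
    primePairs X η = {xy ∈ boxPairs X η | (xy.1 ^ 3 + 2 * xy.2 ^ 3).Prime} := by
  ext ⟨x, y⟩
  simp only [mem_primePairs_iff, mem_filter, mem_boxPairs_iff, and_assoc]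

/-- The algebraic integer `x + y·2^{1/3} ∈ 𝓞_K = ℤ[2^{1/3}]` attached to the pair `(x, y)`.
[cite: HeathBrownActa2001, §3 p. 10] -/
def pairElt (xy : ℕ × ℕ) : 𝓞 K := (xy.1 : 𝓞 K) + (xy.2 : 𝓞 K) * θint

/-- The member `(x + y·2^{1/3})` of `𝒜^(K)` attached to the pair `(x, y)` (a principal ideal of
`𝓞_K`). [cite: HeathBrownActa2001, §3 p. 10] -/
def pairIdeal (xy : ℕ × ℕ) : Ideal (𝓞 K) := Ideal.span {pairElt xy}

/-- `pairElt` with integer casts (the form in which Lemma 3.1 is stated in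
`CubeRootTwoField`). [folklore] -/
theorem pairElt_eq_intCast (xy : ℕ × ℕ) :
    pairElt xy = ((xy.1 : ℤ) : 𝓞 K) + ((xy.2 : ℤ) : 𝓞 K) * θint := by
  simp [pairElt]

/-- `x + y·2^{1/3} ∈ (x + y·2^{1/3})`. [folklore] -/
theorem pairElt_mem_pairIdeal (xy : ℕ × ℕ) : pairElt xy ∈ pairIdeal xy :=
  Ideal.mem_span_singleton_self _

/-- `x + y·2^{1/3} ∈ P` for every ideal `P ∣ (x + y·2^{1/3})`, in the integer-cast form of
Lemma 3.1. [folklore] -/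
theorem intCast_mem_of_dvd_pairIdeal {xy : ℕ × ℕ} {P : Ideal (𝓞 K)} (h : P ∣ pairIdeal xy) :
    ((xy.1 : ℤ) : 𝓞 K) + ((xy.2 : ℤ) : 𝓞 K) * θint ∈ P := by
  rw [← pairElt_eq_intCast]
  exact (Ideal.dvd_iff_le.mp h) (pairElt_mem_pairIdeal xy)

/-- **`N((x + y·2^{1/3})) = x³ + 2y³`**: the members of `𝒜^(K)` have norms the members of `𝒜`.
[cite: HeathBrownActa2001, §3 p. 10] -/
theorem absNorm_pairIdeal (xy : ℕ × ℕ) :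
    Ideal.absNorm (pairIdeal xy) = xy.1 ^ 3 + 2 * xy.2 ^ 3 := by
  rw [pairIdeal, pairElt_eq_intCast, absNorm_span_add_mul_θint,
    show (xy.1 : ℤ) ^ 3 + 2 * (xy.2 : ℤ) ^ 3 = ((xy.1 ^ 3 + 2 * xy.2 ^ 3 : ℕ) : ℤ) by push_cast; ring,
    Int.natAbs_natCast]

/-- `(x + y·2^{1/3}) ≠ 0` unless `x = y = 0`. [folklore] -/
theorem pairIdeal_ne_bot {xy : ℕ × ℕ} (h : xy.1 ≠ 0 ∨ xy.2 ≠ 0) : pairIdeal xy ≠ ⊥ := by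
  intro hbot
  have h0 : Ideal.absNorm (pairIdeal xy) = 0 := by rw [hbot, Ideal.absNorm_bot]
  rw [absNorm_pairIdeal] at h0
  have h1 : xy.1 ^ 3 = 0 := Nat.eq_zero_of_add_eq_zero_right h0
  have h2 : 2 * xy.2 ^ 3 = 0 := Nat.eq_zero_of_add_eq_zero_left h0
  rcases h with h | h
  · exact h ((pow_eq_zero_iff three_ne_zero).mp h1)
  · exact h ((pow_eq_zero_iff three_ne_zero).mp ((mul_eq_zero.mp h2).resolve_left two_ne_zero))

/-- The (finite) set of ideals of `𝓞_K` of norm at most `n` (Mathlib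
`Ideal.finite_setOf_absNorm_le`; it contains `⊥`, of norm `0`). [folklore] -/
def idealsLE (n : ℕ) : Finset (Ideal (𝓞 K)) := (Ideal.finite_setOf_absNorm_le n).toFinset

/-- Membership in `idealsLE`. [folklore] -/
@[simp] theorem mem_idealsLE {n : ℕ} {I : Ideal (𝓞 K)} : I ∈ idealsLE n ↔ Ideal.absNorm I ≤ n := by
  rw [idealsLE, Set.Finite.mem_toFinset, Set.mem_setOf_eq]

/-- Heath-Brown's comparison family over `K`,
`ℬ^(K) = {J : N(J) ∈ (3X³, 3X³(1+η)]}` (p. 10), `J` over the integral ideals of `K = ℚ(2^{1/3})`,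
as a finite set of ideals. [cite: HeathBrownActa2001, §3 p. 10] -/
def normWindow (X η : ℝ) : Finset (Ideal (𝓞 K)) :=
  {J ∈ idealsLE ⌊3 * X ^ 3 * (1 + η)⌋₊ |
      3 * X ^ 3 < (Ideal.absNorm J : ℝ) ∧ (Ideal.absNorm J : ℝ) ≤ 3 * X ^ 3 * (1 + η)}

/-- Membership in `ℬ^(K)`: the bounding norm is redundant. [cite: HeathBrownActa2001, §3 p. 10] -/
theorem mem_normWindow_iff {X η : ℝ} {J : Ideal (𝓞 K)} :
    J ∈ normWindow X η ↔
      3 * X ^ 3 < (Ideal.absNorm J : ℝ) ∧ (Ideal.absNorm J : ℝ) ≤ 3 * X ^ 3 * (1 + η) := by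
  simp only [normWindow, mem_filter, mem_idealsLE, and_iff_right_iff_imp]
  rintro ⟨-, h⟩
  exact Nat.le_floor h

/-- An ideal `I` is `z`-*rough* if every prime ideal factor `P` of `I` has `N(P) ≥ z` (the
condition `P ∣ I → N(P) ≥ z` in Heath-Brown's `S_K(𝒵, z)`, p. 11). [cite: HeathBrownActa2001, §3 p. 11] -/
def IsRough (z : ℝ) (I : Ideal (𝓞 K)) : Prop :=
  ∀ ⦃P : Ideal (𝓞 K)⦄, P.IsPrime → P ∣ I → z ≤ (Ideal.absNorm P : ℝ)

/-- Roughness is monotone in the level: `z₁ ≤ z₂` and `z₂`-rough imply `z₁`-rough. [folklore] -/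
theorem IsRough.mono {z₁ z₂ : ℝ} (h : z₁ ≤ z₂) {I : Ideal (𝓞 K)} (hI : IsRough z₂ I) :
    IsRough z₁ I := fun _ hP hPI => h.trans (hI hP hPI)

open scoped Classical in
/-- `𝒜^(K)_R`: the members of `𝒜^(K)` divisible by the ideal `R` (p. 11: `𝒵_E = {I ∈ 𝒵 : E ∣ I}`),
as a set of indices. [cite: HeathBrownActa2001, §3 p. 11] -/
def APairs (X η : ℝ) (R : Ideal (𝓞 K)) : Finset (ℕ × ℕ) :=
  {xy ∈ boxPairs X η | R ∣ pairIdeal xy}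

open scoped Classical in
/-- `ℬ^(K)_R`: the members of `ℬ^(K)` divisible by the ideal `R`. [cite: HeathBrownActa2001, §3 p. 11] -/
def BIdeals (X η : ℝ) (R : Ideal (𝓞 K)) : Finset (Ideal (𝓞 K)) :=
  {J ∈ normWindow X η | R ∣ J}

open scoped Classical in
/-- **`S_K(𝒜^(K)_R, z) = #{I ∈ 𝒜^(K)_R : P ∣ I → N(P) ≥ z}`** (p. 11), members counted by their
index `(x, y)`. [cite: HeathBrownActa2001, §3 p. 11] -/
def siftedA (X η : ℝ) (R : Ideal (𝓞 K)) (z : ℝ) : ℕ :=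
  #{xy ∈ APairs X η R | IsRough z (pairIdeal xy)}

open scoped Classical in
/-- **`S_K(ℬ^(K)_R, z) = #{J ∈ ℬ^(K)_R : P ∣ J → N(P) ≥ z}`** (p. 11).
[cite: HeathBrownActa2001, §3 p. 11] -/
def siftedB (X η : ℝ) (R : Ideal (𝓞 K)) (z : ℝ) : ℕ :=
  #{J ∈ BIdeals X η R | IsRough z J}

/-- `#𝒜^(K)_R`, the quantity estimated by the Type I bound Lemma 3.2. [cite: HeathBrownActa2001, Lemma 3.2] -/
def countA (X η : ℝ) (R : Ideal (𝓞 K)) : ℕ := #(APairs X η R)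

/-- `#ℬ^(K)_R`, the quantity estimated by the Type I bound Lemma 3.3. [cite: HeathBrownActa2001, Lemma 3.3] -/
def countB (X η : ℝ) (R : Ideal (𝓞 K)) : ℕ := #(BIdeals X η R)

/-- Membership in `𝒜^(K)_R`. [cite: HeathBrownActa2001, §3 p. 11] -/
theorem mem_APairs_iff {X η : ℝ} {R : Ideal (𝓞 K)} {xy : ℕ × ℕ} :
    xy ∈ APairs X η R ↔ xy ∈ boxPairs X η ∧ R ∣ pairIdeal xy := by
  classical
  rw [APairs, mem_filter]

/-- Membership in `ℬ^(K)_R`. [cite: HeathBrownActa2001, §3 p. 11] -/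
theorem mem_BIdeals_iff {X η : ℝ} {R : Ideal (𝓞 K)} {J : Ideal (𝓞 K)} :
    J ∈ BIdeals X η R ↔ J ∈ normWindow X η ∧ R ∣ J := by
  classical
  rw [BIdeals, mem_filter]

/-- `𝒜^(K)_1 = 𝒜^(K)` (the unit ideal divides everything). [folklore] -/
theorem APairs_one (X η : ℝ) : APairs X η 1 = boxPairs X η := by
  classical
  exact filter_true_of_mem fun xy _ => one_dvd _

/-- `ℬ^(K)_1 = ℬ^(K)`. [folklore] -/
theorem BIdeals_one (X η : ℝ) : BIdeals X η 1 = normWindow X η := by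
  classical
  exact filter_true_of_mem fun J _ => one_dvd _


/-! ### Rough ideals of norm below the square of the level are prime (p. 11) -/

/-- A nonzero prime ideal `P` is `z`-rough as soon as `z ≤ N(P)`: its only prime ideal factor is
itself. [folklore] -/
theorem isRough_of_isPrime {P : Ideal (𝓞 K)} (hP : P.IsPrime) (hP0 : P ≠ ⊥) {z : ℝ}
    (hz : z ≤ (Ideal.absNorm P : ℝ)) : IsRough z P := by
  intro Q hQ hQP
  have hPQ : P = Q := (hP.isMaximal hP0).eq_of_le hQ.ne_top (Ideal.dvd_iff_le.mp hQP)
  rw [← hPQ]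
  exact hz

/-- **Rough ideals of norm below the square of the level are prime**: a nonzero proper ideal `I`
all of whose prime ideal factors have norm `≥ z ≥ 0` and with `N(I) < z²` is a prime ideal (write
`I = P·J` with `P` prime; if `J ≠ 1` then `N(I) ≥ N(P)·N(Q) ≥ z²` for a prime `Q ∣ J`). This is
the step "if every prime ideal factor `P` of `x + y·2^{1/3}` has `N(P) ≥ 2X^{3/2}` then
`(x + y·2^{1/3})` will be a prime ideal" of p. 11. [cite: HeathBrownActa2001, §3 p. 11] -/
theorem isPrime_of_isRough {I : Ideal (𝓞 K)} (hI0 : I ≠ ⊥) (hI1 : I ≠ ⊤) {z : ℝ} (hz0 : 0 ≤ z)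
    (hI : IsRough z I) (hlt : (Ideal.absNorm I : ℝ) < z ^ 2) : I.IsPrime := by
  obtain ⟨P, hPmax, hIP⟩ := Ideal.exists_le_maximal I hI1
  obtain ⟨J, rfl⟩ := Ideal.dvd_iff_le.mpr hIP
  by_cases hJ : J = ⊤
  · rw [hJ, Ideal.mul_top]; exact hPmax.isPrime
  exfalso
  have hJ0 : J ≠ ⊥ := by rintro rfl; exact hI0 (Ideal.mul_bot _)
  obtain ⟨Q, hQmax, hJQ⟩ := Ideal.exists_le_maximal J hJ
  have hzP : z ≤ (Ideal.absNorm P : ℝ) := hI hPmax.isPrime (dvd_mul_right P J)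
  have hzQ : z ≤ (Ideal.absNorm Q : ℝ) :=
    hI hQmax.isPrime ((Ideal.dvd_iff_le.mpr hJQ).mul_left P)
  have hQJ : (Ideal.absNorm Q : ℝ) ≤ Ideal.absNorm J := by
    have h := Ideal.absNorm_dvd_absNorm_of_le hJQ
    have hJ0' : Ideal.absNorm J ≠ 0 := fun h0 => hJ0 (Ideal.absNorm_eq_zero_iff.mp h0)
    exact_mod_cast Nat.le_of_dvd (Nat.pos_of_ne_zero hJ0') h
  have h2 : z ^ 2 ≤ (Ideal.absNorm (P * J) : ℝ) := by
    rw [map_mul, Nat.cast_mul, sq]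
    exact mul_le_mul hzP (hzQ.trans hQJ) hz0 (Nat.cast_nonneg _)
  linarith

/-- For a member `I = (x + y·2^{1/3})` of `𝒜^(K)` (`gcd(x, y) = 1`, `I ≠ 0`) and a level `z ≥ 0`
with `z ≤ N(I) < z²`: **`x³ + 2y³` is prime iff `I` is `z`-rough** (p. 11; the reverse direction
uses Lemma 3.1: a prime ideal dividing an element of `𝒜^(K)` has degree `1`, so when `I` is prime
`N(I) = x³ + 2y³` is a rational prime). [cite: HeathBrownActa2001, §3 p. 11] -/
theorem prime_iff_isRough_pairIdeal {xy : ℕ × ℕ} (hxy : Nat.Coprime xy.1 xy.2)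
    (h0 : pairIdeal xy ≠ ⊥) {z : ℝ} (hz0 : 0 ≤ z) (hz : z ≤ (Ideal.absNorm (pairIdeal xy) : ℝ))
    (hlt : (Ideal.absNorm (pairIdeal xy) : ℝ) < z ^ 2) :
    (xy.1 ^ 3 + 2 * xy.2 ^ 3).Prime ↔ IsRough z (pairIdeal xy) := by
  rw [← absNorm_pairIdeal]
  constructor
  · intro hp
    exact isRough_of_isPrime (Ideal.isPrime_of_irreducible_absNorm hp) h0 hz
  · intro hr
    have h1 : pairIdeal xy ≠ ⊤ := by
      intro htop
      rw [htop, Ideal.absNorm_top, Nat.cast_one] at hz hlt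
      nlinarith
    exact prime_absNorm_of_mem (Nat.isCoprime_iff_coprime.mpr hxy) (isPrime_of_isRough h0 h1 hz0 hr hlt)
      h0 (intCast_mem_of_dvd_pairIdeal (dvd_refl _))

/-- `(X^{3/2})² = X³` for `X > 0`. [folklore] -/
theorem two_mul_rpow_three_halves_sq {X : ℝ} (hX : 0 < X) : (2 * X ^ (3 / 2 : ℝ)) ^ 2 = 4 * X ^ 3 := by
  have h : X ^ (3 / 2 : ℝ) * X ^ (3 / 2 : ℝ) = X ^ 3 := by
    rw [← Real.rpow_add hX, show (3 / 2 : ℝ) + 3 / 2 = ((3 : ℕ) : ℝ) by norm_num, Real.rpow_natCast]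
  nlinarith [h]

/-- `X^{3/2} ≤ X³` for `X ≥ 1`. [folklore] -/
theorem rpow_three_halves_le_pow_three {X : ℝ} (hX : 1 ≤ X) : X ^ (3 / 2 : ℝ) ≤ X ^ 3 :=
  calc X ^ (3 / 2 : ℝ) ≤ X ^ ((3 : ℕ) : ℝ) := Real.rpow_le_rpow_of_exponent_le hX (by norm_num)
    _ = X ^ 3 := Real.rpow_natCast X 3

/-- The norm of a member of `𝒜^(K)` lies in `(3X³, 4X³)` when `X > 0`, `0 ≤ η ≤ 1/10`
(`3·(1.1)³ = 3.993 < 4`). [cite: HeathBrownActa2001, §3 p. 11] -/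
theorem absNorm_pairIdeal_mem_Ioo {X η : ℝ} (hX : 0 < X) (hη0 : 0 ≤ η) (hη : η ≤ 1 / 10)
    {xy : ℕ × ℕ} (hxy : xy ∈ boxPairs X η) :
    3 * X ^ 3 < (Ideal.absNorm (pairIdeal xy) : ℝ) ∧ (Ideal.absNorm (pairIdeal xy) : ℝ) < 4 * X ^ 3 := by
  rw [mem_boxPairs_iff] at hxy
  obtain ⟨hx1, hx2, hy1, hy2, -⟩ := hxy
  have hN : (Ideal.absNorm (pairIdeal xy) : ℝ) = (xy.1 : ℝ) ^ 3 + 2 * (xy.2 : ℝ) ^ 3 := by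
    rw [absNorm_pairIdeal]; push_cast; ring
  rw [hN]
  have hx3 : X ^ 3 < (xy.1 : ℝ) ^ 3 := pow_lt_pow_left₀ hx1 hX.le three_ne_zero
  have hy3 : X ^ 3 < (xy.2 : ℝ) ^ 3 := pow_lt_pow_left₀ hy1 hX.le three_ne_zero
  have hx3' : (xy.1 : ℝ) ^ 3 ≤ (X * (1 + η)) ^ 3 := pow_le_pow_left₀ (by positivity) hx2 3
  have hy3' : (xy.2 : ℝ) ^ 3 ≤ (X * (1 + η)) ^ 3 := pow_le_pow_left₀ (by positivity) hy2 3
  have hη3 : (1 + η) ^ 3 ≤ 1.331 :=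
    calc (1 + η) ^ 3 ≤ (1.1 : ℝ) ^ 3 := pow_le_pow_left₀ (by linarith) (by norm_num; linarith) 3
      _ = 1.331 := by norm_num
  have hbox : (X * (1 + η)) ^ 3 ≤ 1.331 * X ^ 3 := by
    rw [mul_pow]; nlinarith [pow_pos hX 3]
  constructor
  · linarith
  · nlinarith [pow_pos hX 3]

/-- **`π(𝒜) = S_K(𝒜^(K), 2X^{3/2})`** (p. 11), for `X ≥ 1` and `0 ≤ η ≤ 1/10`: a member
`(x + y·2^{1/3})` of `𝒜^(K)` has norm `x³ + 2y³ ∈ (3X³, 4X³)`, at least the level `2X^{3/2}` and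
below its square `4X³`, so it is `2X^{3/2}`-rough iff `x³ + 2y³` is prime
(`prime_iff_isRough_pairIdeal`). (The paper uses the identity for `η → 0`; some smallness of `η` is
needed, since for `η` near `1` the norm `x³ + 2y³` may exceed `(2X^{3/2})² = 4X³`; the constant `1/10`
is ours.) [cite: HeathBrownActa2001, §3 p. 11] -/
theorem primePairCount_eq_siftedA {X η : ℝ} (hX : 1 ≤ X) (hη0 : 0 ≤ η) (hη : η ≤ 1 / 10) :
    primePairCount X η = siftedA X η 1 (2 * X ^ (3 / 2 : ℝ)) := by
  classical
  rw [primePairCount_def, primePairs_eq_filter, siftedA, APairs_one]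
  refine congr_arg _ (filter_congr fun xy hxy => ?_)
  have hX0 : 0 < X := by linarith
  obtain ⟨hgt, hlt⟩ := absNorm_pairIdeal_mem_Ioo hX0 hη0 hη hxy
  rw [mem_boxPairs_iff] at hxy
  obtain ⟨hx1, -, -, -, hcop⟩ := hxy
  have hxne : xy.1 ≠ 0 := by
    rintro h
    rw [h, Nat.cast_zero] at hx1
    linarith
  have h32 := rpow_three_halves_le_pow_three hX
  refine prime_iff_isRough_pairIdeal hcop (pairIdeal_ne_bot (Or.inl hxne)) (by positivity)
    (by linarith) ?_
  rw [two_mul_rpow_three_halves_sq hX0]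
  exact hlt

/-! ### `ℬ^(K)` at the level `2X^{3/2}`: the prime ideals with norm in the window (p. 13) -/

open scoped Classical in
/-- **`S_K(ℬ^(K), 2X^{3/2})` is the number of prime ideals with norm in `(3X³, 3X³(1+η)]`**
(`X ≥ 1`, `0 ≤ η < 1/3`, so that the window lies in `[2X^{3/2}, 4X³)`): a `2X^{3/2}`-rough member of
`ℬ^(K)` is prime (`isPrime_of_isRough`), and conversely. [cite: HeathBrownActa2001, §3 p. 13] -/
theorem siftedB_one_eq_card_filter_isPrime {X η : ℝ} (hX : 1 ≤ X) (hη0 : 0 ≤ η) (hη : η < 1 / 3) :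
    siftedB X η 1 (2 * X ^ (3 / 2 : ℝ)) = #{P ∈ normWindow X η | P.IsPrime} := by
  classical
  rw [siftedB, BIdeals_one]
  refine congr_arg _ (filter_congr fun J hJ => ?_)
  rw [mem_normWindow_iff] at hJ
  obtain ⟨hJ1, hJ2⟩ := hJ
  have hX0 : 0 < X := by linarith
  have h32 := rpow_three_halves_le_pow_three hX
  have hX3 : 1 ≤ X ^ 3 := one_le_pow₀ hX
  have hJ0 : J ≠ ⊥ := by
    intro h; rw [h, Ideal.absNorm_bot, Nat.cast_zero] at hJ1; nlinarith
  have hJtop : J ≠ ⊤ := by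
    intro h; rw [h, Ideal.absNorm_top, Nat.cast_one] at hJ1; nlinarith
  constructor
  · intro hr
    refine isPrime_of_isRough hJ0 hJtop (by positivity) hr ?_
    rw [two_mul_rpow_three_halves_sq hX0]
    nlinarith
  · intro hP
    exact isRough_of_isPrime hP hJ0 (by nlinarith)

/-- **Dedekind's theorem for `K`, counted**: for every prime `p`, `ν_p = #{I ◁ 𝓞_K : N(I) = p}`
(`CubeRootTwoField.card_absNorm_eq_prime` in Heath-Brown's notation `ν_p`, pp. 2, 6, 21).
[cite: HeathBrownActa2001, §4 p. 21] -/
theorem card_absNorm_eq_prime_eq_cubeRootTwoCount {p : ℕ} (hp : p.Prime) :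
    Nat.card {I : Ideal (𝓞 K) // Ideal.absNorm I = p} = cubeRootTwoCount p := by
  rw [card_absNorm_eq_prime hp, cubeRootTwoCount_eq_polyRootCountMod, polyRootCountMod_single]

/-- `π(ℬ) = ∑_{p ∈ (3X³, 3X³(1+η)]} ν_p` is the number of members of `ℬ^(K)` of prime norm (the
first-degree prime ideals with norm in the window, p. 5). [cite: HeathBrownActa2001, §2 p. 5] -/
theorem card_filter_prime_absNorm_eq_normPrimeCount (X η : ℝ) :
    #{J ∈ normWindow X η | (Ideal.absNorm J).Prime} = normPrimeCount X η := by
  classical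
  rw [normPrimeCount_def, card_eq_sum_card_fiberwise (f := fun J => Ideal.absNorm J)
    (t := (Iic ⌊3 * X ^ 3 * (1 + η)⌋₊).filter
      (fun p : ℕ => p.Prime ∧ 3 * X ^ 3 < (p : ℝ) ∧ (p : ℝ) ≤ 3 * X ^ 3 * (1 + η)))]
  · refine sum_congr rfl fun p hp => ?_
    simp only [mem_filter, mem_Iic] at hp
    obtain ⟨-, hpP, hp1, hp2⟩ := hp
    have hiff : ∀ J : Ideal (𝓞 K),
        J ∈ ({J ∈ ({J ∈ normWindow X η | (Ideal.absNorm J).Prime} : Finset (Ideal (𝓞 K))) |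
          Ideal.absNorm J = p} : Finset (Ideal (𝓞 K))) ↔ Ideal.absNorm J = p := by
      intro J
      simp only [mem_filter, mem_normWindow_iff]
      constructor
      · exact fun h => h.2
      · intro h
        rw [h]
        exact ⟨⟨⟨hp1, hp2⟩, hpP⟩, rfl⟩
    rw [← card_absNorm_eq_prime_eq_cubeRootTwoCount hpP, ← Nat.card_eq_finsetCard]
    exact Nat.card_congr (Equiv.subtypeEquivRight hiff)
  · intro J hJ
    rw [mem_coe, mem_filter, mem_normWindow_iff] at hJ
    obtain ⟨⟨h1, h2⟩, hp⟩ := hJ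
    rw [mem_coe, mem_filter, mem_Iic]
    exact ⟨Nat.le_floor h2, hp, h1, h2⟩

open scoped Classical in
/-- **`S_K(ℬ^(K), 2X^{3/2}) = π(ℬ) + #{P prime : N(P) ∈ (3X³, 3X³(1+η)], N(P) not prime}`**
(`X ≥ 1`, `0 ≤ η < 1/3`): p. 13, "`J ∈ ℬ^(K)` can be a prime ideal without `N(J)` being prime.
Thus `π(ℬ) = S_K(ℬ^(K), 2X^{3/2}) + O(X²)`" — the exact form; the `O`-bound is
`card_normWindow_isPrime_not_prime_le`. [cite: HeathBrownActa2001, §3 p. 13] -/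
theorem siftedB_one_eq_normPrimeCount_add {X η : ℝ} (hX : 1 ≤ X) (hη0 : 0 ≤ η) (hη : η < 1 / 3) :
    siftedB X η 1 (2 * X ^ (3 / 2 : ℝ)) =
      normPrimeCount X η + #{P ∈ normWindow X η | P.IsPrime ∧ ¬ (Ideal.absNorm P).Prime} := by
  classical
  rw [siftedB_one_eq_card_filter_isPrime hX hη0 hη,
    ← card_filter_prime_absNorm_eq_normPrimeCount X η,
    ← card_filter_add_card_filter_not (p := fun P => (Ideal.absNorm P).Prime)
      (s := ({P ∈ normWindow X η | P.IsPrime} : Finset (Ideal (𝓞 K))))]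
  congr 1
  · rw [filter_filter]
    refine congr_arg _ (filter_congr fun J _ => ?_)
    exact ⟨fun h => h.2, fun h => ⟨Ideal.isPrime_of_irreducible_absNorm h, h⟩⟩
  · rw [filter_filter]

open scoped Classical in
/-- The correction term is `O(X^{3/2})`: the prime ideals with norm in the window whose norm is not
prime number at most `[K:ℚ](√(3X³(1+η)) + 1) = 3√(3(1+η)) X^{3/2} + 3` (each lies over a rational
prime `q ≤ √(3X³(1+η))`, at most `3` over each `q`; `HeathBrownCubicPrimesOutlineProofs.card_filter_not_prime_absNorm_le`).
Heath-Brown records the weaker `O(X²)` (p. 13). [cite: HeathBrownActa2001, §3 p. 13] -/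
theorem card_normWindow_isPrime_not_prime_le {X η : ℝ} (hX : 0 ≤ X) :
    (#{P ∈ normWindow X η | P.IsPrime ∧ ¬ (Ideal.absNorm P).Prime} : ℝ) ≤
      3 * (Real.sqrt (3 * X ^ 3 * (1 + η)) + 1) := by
  classical
  have hsub : ({P ∈ normWindow X η | P.IsPrime ∧ ¬ (Ideal.absNorm P).Prime} : Finset (Ideal (𝓞 K))) ⊆
      (Literature.NumberTheory.LFunctions.NumberField.finite_primeIdealsLE K (3 * X ^ 3 * (1 + η))).toFinset.filter
        fun P => ¬ (Ideal.absNorm P).Prime := by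
    intro P hP
    simp only [mem_filter, mem_normWindow_iff] at hP
    obtain ⟨⟨h1, h2⟩, hPp, hnp⟩ := hP
    simp only [mem_filter, Set.Finite.mem_toFinset, Literature.NumberTheory.LFunctions.NumberField.primeIdealsLE, Set.mem_setOf_eq]
    refine ⟨⟨hPp, ?_, h2⟩, hnp⟩
    intro hbot
    rw [hbot, Ideal.absNorm_bot, Nat.cast_zero] at h1
    nlinarith [pow_nonneg hX 3]
  calc (#{P ∈ normWindow X η | P.IsPrime ∧ ¬ (Ideal.absNorm P).Prime} : ℝ)
      ≤ #((Literature.NumberTheory.LFunctions.NumberField.finite_primeIdealsLE K (3 * X ^ 3 * (1 + η))).toFinset.filter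
          fun P => ¬ (Ideal.absNorm P).Prime) := by exact_mod_cast card_le_card hsub
    _ ≤ Module.finrank ℚ K * (Real.sqrt (3 * X ^ 3 * (1 + η)) + 1) :=
        card_filter_not_prime_absNorm_le _
    _ = 3 * (Real.sqrt (3 * X ^ 3 * (1 + η)) + 1) := by rw [finrank_K]; norm_num


/-! ### Buchstab's identity over `K` (p. 12) -/

open scoped Classical in
/-- The nonzero prime ideals `P` with `z₁ ≤ N(P) < z₂`: the range of the Buchstab sums
`∑_{z₁ ≤ N(P) < z₂} S_K(𝒵_P, N(P))` (p. 12). [cite: HeathBrownActa2001, §3 p. 12] -/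
def primesNormIco (z₁ z₂ : ℝ) : Finset (Ideal (𝓞 K)) :=
  {P ∈ idealsLE ⌊z₂⌋₊ | P.IsPrime ∧ P ≠ ⊥ ∧ z₁ ≤ (Ideal.absNorm P : ℝ) ∧ (Ideal.absNorm P : ℝ) < z₂}

/-- Membership in `primesNormIco`: the bounding norm is redundant. [cite: HeathBrownActa2001, §3 p. 12] -/
theorem mem_primesNormIco_iff {z₁ z₂ : ℝ} {P : Ideal (𝓞 K)} :
    P ∈ primesNormIco z₁ z₂ ↔
      P.IsPrime ∧ P ≠ ⊥ ∧ z₁ ≤ (Ideal.absNorm P : ℝ) ∧ (Ideal.absNorm P : ℝ) < z₂ := by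
  classical
  simp only [primesNormIco, mem_filter, mem_idealsLE, and_iff_right_iff_imp]
  rintro ⟨-, -, -, h⟩
  exact Nat.le_floor h.le

open scoped Classical in
/-- The prime ideal factors of an ideal `I`, as a finite set (for `I ≠ 0` a divisor has norm
dividing, hence at most, `N(I)`). [folklore] -/
def primeFactorsFinset (I : Ideal (𝓞 K)) : Finset (Ideal (𝓞 K)) :=
  {P ∈ idealsLE (Ideal.absNorm I) | P.IsPrime ∧ P ∣ I}

/-- Membership in `primeFactorsFinset I` for `I ≠ 0`. [folklore] -/
theorem mem_primeFactorsFinset_iff {I P : Ideal (𝓞 K)} (hI : I ≠ ⊥) :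
    P ∈ primeFactorsFinset I ↔ P.IsPrime ∧ P ∣ I := by
  classical
  simp only [primeFactorsFinset, mem_filter, mem_idealsLE, and_iff_right_iff_imp]
  rintro ⟨-, hPI⟩
  exact Nat.le_of_dvd (Nat.pos_of_ne_zero fun h0 => hI (Ideal.absNorm_eq_zero_iff.mp h0))
    (Ideal.absNorm_dvd_absNorm_of_le (Ideal.dvd_iff_le.mp hPI))

/-- The members of `primeFactorsFinset I`, `I ≠ 0`, are nonzero. [folklore] -/
theorem ne_bot_of_mem_primeFactorsFinset {I P : Ideal (𝓞 K)} (hI : I ≠ ⊥)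
    (hP : P ∈ primeFactorsFinset I) : P ≠ ⊥ := by
  rintro rfl
  obtain ⟨-, h⟩ := (mem_primeFactorsFinset_iff hI).mp hP
  rw [← Ideal.zero_eq_bot, zero_dvd_iff, Ideal.zero_eq_bot] at h
  exact hI h

open scoped Classical in
/-- **Buchstab's identity over `K`** for a finite family of nonzero ideals `I i`, `i ∈ 𝒵`, in which
no member has two distinct prime ideal factors of equal norm: for `z₁ ≤ z₂`,
`S(𝒵, z₁) = S(𝒵, z₂) + ∑_{z₁ ≤ N(P) < z₂} S(𝒵_P, N(P))`, where `S(𝒵, z)` counts the `z`-rough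
members and `𝒵_P` is the subfamily divisible by `P` (classify a `z₁`-rough, non-`z₂`-rough member
by its prime ideal factor of least norm, unique by the hypothesis). P. 12: "Buchstab's identity
now yields …"; "the various prime ideals `P_i` which occur when Buchstab's identity is applied must
have distinct norms, by Lemma 3.1". (Over `K`, unlike over `ℚ`, distinct prime ideals may share a
norm; without the hypothesis the right side over-counts — the situation of `ℬ^(K)`, p. 13.)
[cite: HeathBrownActa2001, §3 p. 12] -/
theorem buchstab_identity {ι : Type*} (E : Finset ι) (I : ι → Ideal (𝓞 K))
    (h0 : ∀ i ∈ E, I i ≠ ⊥)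
    (hdist : ∀ i ∈ E, ∀ ⦃P₁ P₂ : Ideal (𝓞 K)⦄, P₁.IsPrime → P₂.IsPrime → P₁ ≠ ⊥ →
      P₁ ∣ I i → P₂ ∣ I i → Ideal.absNorm P₁ = Ideal.absNorm P₂ → P₁ = P₂)
    {z₁ z₂ : ℝ} (hz : z₁ ≤ z₂) :
    #{i ∈ E | IsRough z₁ (I i)} =
      #{i ∈ E | IsRough z₂ (I i)} +
        ∑ P ∈ primesNormIco z₁ z₂, #{i ∈ E | P ∣ I i ∧ IsRough (Ideal.absNorm P) (I i)} := by
  have hsplit : ({i ∈ E | IsRough z₁ (I i)} : Finset ι) =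
      {i ∈ E | IsRough z₂ (I i)} ∪ {i ∈ E | IsRough z₁ (I i) ∧ ¬ IsRough z₂ (I i)} := by
    ext i
    simp only [mem_filter, mem_union]
    constructor
    · rintro ⟨hi, h1⟩
      by_cases h2 : IsRough z₂ (I i)
      · exact Or.inl ⟨hi, h2⟩
      · exact Or.inr ⟨hi, h1, h2⟩
    · rintro (⟨hi, h2⟩ | ⟨hi, h1, -⟩)
      · exact ⟨hi, h2.mono hz⟩
      · exact ⟨hi, h1⟩
  have hdisj : Disjoint ({i ∈ E | IsRough z₂ (I i)} : Finset ι)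
      {i ∈ E | IsRough z₁ (I i) ∧ ¬ IsRough z₂ (I i)} := by
    rw [disjoint_filter]
    rintro i - h2 ⟨-, h2'⟩
    exact h2' h2
  rw [hsplit, card_union_of_disjoint hdisj]
  congr 1
  have hfib : ({i ∈ E | IsRough z₁ (I i) ∧ ¬ IsRough z₂ (I i)} : Finset ι) =
      (primesNormIco z₁ z₂).biUnion
        fun P => {i ∈ E | P ∣ I i ∧ IsRough (Ideal.absNorm P) (I i)} := by
    ext i
    simp only [mem_filter, mem_biUnion, mem_primesNormIco_iff]
    constructor
    · rintro ⟨hi, h1, h2⟩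
      simp only [IsRough, not_forall, not_le, exists_prop] at h2
      obtain ⟨P, hP, hPI, hlt⟩ := h2
      have hne : (primeFactorsFinset (I i)).Nonempty :=
        ⟨P, (mem_primeFactorsFinset_iff (h0 i hi)).mpr ⟨hP, hPI⟩⟩
      obtain ⟨P₀, hP₀, hmin⟩ := exists_min_image _ (fun P => Ideal.absNorm P) hne
      have hP₀0 : P₀ ≠ ⊥ := ne_bot_of_mem_primeFactorsFinset (h0 i hi) hP₀
      rw [mem_primeFactorsFinset_iff (h0 i hi)] at hP₀
      obtain ⟨hP₀p, hP₀I⟩ := hP₀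
      have hrough : IsRough (Ideal.absNorm P₀) (I i) := by
        intro Q hQ hQI
        exact_mod_cast hmin Q ((mem_primeFactorsFinset_iff (h0 i hi)).mpr ⟨hQ, hQI⟩)
      refine ⟨P₀, ⟨hP₀p, hP₀0, h1 hP₀p hP₀I, ?_⟩, hi, hP₀I, hrough⟩
      calc (Ideal.absNorm P₀ : ℝ) ≤ Ideal.absNorm P := by
            exact_mod_cast hmin P ((mem_primeFactorsFinset_iff (h0 i hi)).mpr ⟨hP, hPI⟩)
        _ < z₂ := hlt
    · rintro ⟨P, ⟨hP, -, hz1, hz2⟩, hi, hPI, hrough⟩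
      refine ⟨hi, hrough.mono hz1, fun h2 => ?_⟩
      have := h2 hP hPI
      linarith
  rw [hfib, card_biUnion]
  intro P₁ hP₁ P₂ hP₂ hne
  rw [mem_coe, mem_primesNormIco_iff] at hP₁ hP₂
  change Disjoint _ _
  rw [disjoint_filter]
  rintro i hi ⟨h1I, h1r⟩ ⟨h2I, h2r⟩
  have h12 : (Ideal.absNorm P₁ : ℝ) ≤ Ideal.absNorm P₂ := h1r hP₂.1 h2I
  have h21 : (Ideal.absNorm P₂ : ℝ) ≤ Ideal.absNorm P₁ := h2r hP₁.1 h1I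
  exact hne (hdist i hi hP₁.1 hP₂.1 hP₁.2.1 h1I h2I (by exact_mod_cast le_antisymm h12 h21))

open scoped Classical in
/-- **Buchstab's identity for `𝒜^(K)_R`** (p. 12), exact: for `X ≥ 1` and `z₁ ≤ z₂`,
`S_K(𝒜^(K)_R, z₁) = S_K(𝒜^(K)_R, z₂) + ∑_{z₁ ≤ N(P) < z₂} #{I ∈ 𝒜^(K)_R : P ∣ I, (Q ∣ I → N(Q) ≥ N(P))}`;
by Lemma 3.1 no member of `𝒜^(K)` has two distinct prime ideal factors of the same norm, so
`buchstab_identity` applies ("the various prime ideals `P_i` … must have distinct norms, by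
Lemma 3.1", p. 12). When `P ∤ R` the summand is `S_K(𝒜^(K)_{RP}, N(P))`
(`card_filter_dvd_isRough_eq_siftedA`), the form iterated in (3.1). [cite: HeathBrownActa2001, §3 p. 12] -/
theorem siftedA_buchstab {X : ℝ} (hX : 1 ≤ X) (η : ℝ) (R : Ideal (𝓞 K)) {z₁ z₂ : ℝ} (hz : z₁ ≤ z₂) :
    siftedA X η R z₁ = siftedA X η R z₂ +
      ∑ P ∈ primesNormIco z₁ z₂,
        #{xy ∈ APairs X η R | P ∣ pairIdeal xy ∧ IsRough (Ideal.absNorm P) (pairIdeal xy)} := by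
  unfold siftedA
  refine buchstab_identity (APairs X η R) pairIdeal (fun xy hxy => ?_)
    (fun xy hxy P₁ P₂ hP₁ hP₂ hP₁0 h₁ h₂ hN => ?_) hz
  · rw [mem_APairs_iff, mem_boxPairs_iff] at hxy
    refine pairIdeal_ne_bot (Or.inl ?_)
    rintro h
    obtain ⟨⟨hx1, -⟩, -⟩ := hxy
    rw [h, Nat.cast_zero] at hx1
    linarith
  · rw [mem_APairs_iff, mem_boxPairs_iff] at hxy
    exact eq_of_mem_of_absNorm_eq (Nat.isCoprime_iff_coprime.mpr hxy.1.2.2.2.2) hP₁ hP₁0 hP₂.ne_top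
      (intCast_mem_of_dvd_pairIdeal h₁) (intCast_mem_of_dvd_pairIdeal h₂) hN

/-- A nonzero prime ideal not dividing `R` is coprime to `R`: `R + P = 1`. [folklore] -/
theorem isCoprime_of_not_dvd {R P : Ideal (𝓞 K)} (hP : P.IsPrime) (hP0 : P ≠ ⊥) (hPR : ¬ P ∣ R) :
    IsCoprime R P := by
  rw [Ideal.isCoprime_iff_sup_eq]
  rcases eq_or_lt_of_le (le_sup_right : P ≤ R ⊔ P) with h | h
  · exact absurd (Ideal.dvd_iff_le.mpr (le_sup_left.trans h.ge)) hPR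
  · exact (hP.isMaximal hP0).out.2 _ h

open scoped Classical in
/-- For a nonzero prime `P ∤ R`, the `z`-rough members of `𝒜^(K)_R` divisible by `P` are the
`z`-rough members of `𝒜^(K)_{RP}` (`R ∣ I ∧ P ∣ I ↔ RP ∣ I` as `R + P = 1`). In (3.1) the new prime
`P_{n+1}` has smaller norm than every `P_i ∣ R = P_1⋯P_n`, so indeed `P_{n+1} ∤ R`.
[cite: HeathBrownActa2001, §3 (3.1)] -/
theorem card_filter_dvd_isRough_eq_siftedA (X η : ℝ) {R P : Ideal (𝓞 K)} (hP : P.IsPrime)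
    (hP0 : P ≠ ⊥) (hPR : ¬ P ∣ R) (z : ℝ) :
    #{xy ∈ APairs X η R | P ∣ pairIdeal xy ∧ IsRough z (pairIdeal xy)} = siftedA X η (R * P) z := by
  have hcop : IsCoprime R P := isCoprime_of_not_dvd hP hP0 hPR
  have hiff : ∀ I : Ideal (𝓞 K), R ∣ I ∧ P ∣ I ↔ R * P ∣ I := fun I =>
    ⟨fun h => hcop.mul_dvd h.1 h.2, fun h => ⟨dvd_of_mul_right_dvd h, dvd_of_mul_left_dvd h⟩⟩
  unfold siftedA
  congr 1
  ext xy
  simp only [mem_filter, mem_APairs_iff]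
  constructor
  · rintro ⟨⟨hb, hR⟩, hPI, hr⟩
    exact ⟨⟨hb, (hiff _).mp ⟨hR, hPI⟩⟩, hr⟩
  · rintro ⟨⟨hb, hRP⟩, hr⟩
    obtain ⟨hR, hPI⟩ := (hiff _).mpr hRP
    exact ⟨⟨hb, hR⟩, hPI, hr⟩

/-! ### The Type I bounds over `K` (Lemmas 3.2 and 3.3) — named facts -/

open scoped Classical in
/-- `τ(R)`, the number of ideal divisors of `R` (the divisor function on ideals weighting the Type I
sums, pp. 11, 22; for `R ≠ 0` a divisor has norm dividing, hence at most, `N(R)`).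
[cite: HeathBrownActa2001, Lemma 3.2] -/
def idealDivisorCount (R : Ideal (𝓞 K)) : ℕ := #{D ∈ idealsLE (Ideal.absNorm R) | D ∣ R}

/-- Heath-Brown's density `ρ₂(R)`, "the multiplicative function on ideals defined by
`ρ₂(P^e) = (1 + N(P)^{-1})^{-1}`" (Lemma 3.2), i.e. `ρ₂(R) = ∏_{P ∣ R, P prime} (1 + N(P)^{-1})^{-1}`.
[cite: HeathBrownActa2001, Lemma 3.2] -/
def rho₂ (R : Ideal (𝓞 K)) : ℝ :=
  ∏ P ∈ primeFactorsFinset R, (1 + (Ideal.absNorm P : ℝ)⁻¹)⁻¹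

/-- `γ₀`, "the residue of the pole of the Dedekind zeta-function `ζ_K(s)` at `s = 1`" (p. 6, the
density of the ideals of `K`: `#{J : N(J) ≤ x} = γ₀x + O(x^{2/3})`, Lemma 4.1), as Mathlib's
class-number-formula value `NumberField.dedekindZeta_residue K`
(`2^{r₁}(2π)^{r₂} h R / (w √|d|)`; here `r₁ = r₂ = 1`, `h = 1`, `w = 2`, `d = −108`,
`R = log(1 + 2^{1/3} + 2^{2/3})`). [cite: HeathBrownActa2001, Lemma 2.2] -/
def gamma₀ : ℝ := NumberField.dedekindZeta_residue K

/-- `γ₀ > 0`. [folklore] -/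
theorem gamma₀_pos : 0 < gamma₀ := NumberField.dedekindZeta_residue_pos K

open scoped Classical in
/-- **Heath-Brown's Lemma 3.2 — the Type I bound for `𝒜^(K)` (level of distribution `X^{2−ε}`)**:
"Let `ρ₂(R)` be the multiplicative function on ideals defined by `ρ₂(P^e) = (1 + N(P)^{-1})^{-1}`.
Then for any positive integer `A` there exists a corresponding `c(A)` such that
`∑_{Q < N(R) ≤ 2Q, R ∈ 𝒯r} τ(R)^A |#𝒜^(K)_R − (6η²X²/π²) ρ₂(R)/N(R)| ≪ (Q + XQ^{1/2} + X^{3/2})(log QX)^{c(A)}`.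
Here `𝒯r` is the set of ideals `R` for which `N(R)` is square-free" (p. 11; proved in §5,
pp. 28–32; implied constants depend on `A` only, p. 6). Rendered with explicit constants, for
`X ≥ 2`, `η` in the standing range (2.1) `exp(−(log X)^{1/3}) ≤ η ≤ 1`, and `Q ≥ 1`.
[cite: HeathBrownActa2001, Lemma 3.2] -/
def HeathBrown2001_typeI_A : Prop :=
  ∀ A : ℕ, 0 < A → ∃ c C : ℝ, ∀ X η Q : ℝ, 2 ≤ X →
    Real.exp (-Real.log X ^ (1 / 3 : ℝ)) ≤ η → η ≤ 1 → 1 ≤ Q →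
      ∑ R ∈ (idealsLE ⌊2 * Q⌋₊).filter (fun R => Q < (Ideal.absNorm R : ℝ) ∧
          (Ideal.absNorm R : ℝ) ≤ 2 * Q ∧ Squarefree (Ideal.absNorm R)),
        (idealDivisorCount R : ℝ) ^ A *
          |(countA X η R : ℝ) - 6 * η ^ 2 * X ^ 2 / Real.pi ^ 2 * rho₂ R / Ideal.absNorm R| ≤
      C * (Q + X * Real.sqrt Q + X ^ (3 / 2 : ℝ)) * Real.log (Q * X) ^ c

open scoped Classical in
/-- **Heath-Brown's Lemma 3.3 — the Type I bound for `ℬ^(K)` (level of distribution `X^{3−ε}`)**: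
"For any positive integer `A` there exists a corresponding `c(A)` such that
`∑_{Q < N(R) ≤ 2Q} τ(R)^A |#ℬ^(K)_R − γ₀ · 3ηX³/N(R)| ≪ X² Q^{1/3} (log Q)^{c(A)}`" (p. 11; proved on
p. 32 from Weber's `#{I : N(I) ≤ x} = γ₀x + O(x^{2/3})`, Lemma 4.1, via (5.7)
`#ℬ^(K)_R = 3γ₀ηX³N(R)^{-1} + O(X²N(R)^{-2/3})`), `γ₀` the residue of `ζ_K` at `1` (`gamma₀`).
Rendered with explicit constants, for `X ≥ 2`, `η` in the range (2.1), and `Q ≥ 2` (so that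
`log Q > 0`). [cite: HeathBrownActa2001, Lemma 3.3] -/
def HeathBrown2001_typeI_B : Prop :=
  ∀ A : ℕ, 0 < A → ∃ c C : ℝ, ∀ X η Q : ℝ, 2 ≤ X →
    Real.exp (-Real.log X ^ (1 / 3 : ℝ)) ≤ η → η ≤ 1 → 2 ≤ Q →
      ∑ R ∈ (idealsLE ⌊2 * Q⌋₊).filter (fun R => Q < (Ideal.absNorm R : ℝ) ∧
          (Ideal.absNorm R : ℝ) ≤ 2 * Q),
        (idealDivisorCount R : ℝ) ^ A *
          |(countB X η R : ℝ) - gamma₀ * (3 * η * X ^ 3) / Ideal.absNorm R| ≤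
      C * X ^ 2 * Q ^ (1 / 3 : ℝ) * Real.log Q ^ c


/-! ### The members of `𝒜^(K)` are distinct ideals (p. 10) -/

/-- Every algebraic integer of `K` has integer coordinates in `1, θ, θ²` (`𝓞_K = ℤ[θ]`,
`CubeRootTwoField.adjoin_θint_eq_top`, reduced modulo the monic cubic `X³ − 2`). [folklore] -/
theorem exists_int_coords (u : 𝓞 K) : ∃ a b c : ℤ, u = a + b * θint + c * θint ^ 2 := by
  have hu : u ∈ Algebra.adjoin ℤ ({θint} : Set (𝓞 K)) := by
    rw [adjoin_θint_eq_top]; exact Algebra.mem_top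
  rw [Algebra.adjoin_singleton_eq_range_aeval] at hu
  obtain ⟨p, hp⟩ := (AlgHom.mem_range _).mp hu
  have h0 : aeval θint cubicPoly = 0 := by rw [← minpoly_θint]; exact minpoly.aeval ℤ θint
  have hne1 : cubicPoly ≠ 1 := by
    intro h
    have := congr_arg natDegree h
    rw [cubicPoly_natDegree, natDegree_one] at this
    exact absurd this (by norm_num)
  set q := p %ₘ cubicPoly with hq
  have hmod : aeval θint q = u := by
    rw [hq, aeval_modByMonic_eq_self_of_root h0, hp]
  have hdeg : q.natDegree < 3 := by
    have := natDegree_modByMonic_lt p cubicPoly_monic hne1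
    rwa [cubicPoly_natDegree] at this
  refine ⟨q.coeff 0, q.coeff 1, q.coeff 2, ?_⟩
  rw [← hmod]
  conv_lhs => rw [as_sum_range' q 3 hdeg]
  simp only [Finset.sum_range_succ, Finset.sum_range_zero, map_add, aeval_monomial,
    algebraMap_int_eq, eq_intCast, zero_add, pow_zero, mul_one, pow_one]

/-- `1, θ, θ²` are linearly independent over `ℚ`: an integer combination `a + bθ + cθ²` vanishes in
`K` only if `a = b = c = 0` (a nonzero rational polynomial of degree `≤ 2` is not divisible by the
cubic `X³ − 2`). [folklore] -/
theorem intCoords_eq_zero {a b c : ℤ} (h : (a : K) + b * θ + c * θ ^ 2 = 0) :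
    a = 0 ∧ b = 0 ∧ c = 0 := by
  set q : ℚ[X] := C (c : ℚ) * X ^ 2 + C (b : ℚ) * X + C (a : ℚ) with hq
  have hmk : AdjoinRoot.mk cubicPolyRat q = 0 := by
    rw [hq, map_add, map_add, map_mul, map_mul, map_pow, AdjoinRoot.mk_X, AdjoinRoot.mk_C,
      AdjoinRoot.mk_C, AdjoinRoot.mk_C, map_intCast, map_intCast, map_intCast, ← h,
      show AdjoinRoot.root cubicPolyRat = θ from rfl]
    ring
  rw [AdjoinRoot.mk_eq_zero] at hmk
  have hq0 : q = 0 := Polynomial.eq_zero_of_dvd_of_degree_lt hmk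
    (by rw [cubicPolyRat_degree, hq]; exact degree_quadratic_le.trans_lt (by decide))
  have h0 := congr_arg (fun r : ℚ[X] => r.coeff 0) hq0
  have h1 := congr_arg (fun r : ℚ[X] => r.coeff 1) hq0
  have h2 := congr_arg (fun r : ℚ[X] => r.coeff 2) hq0
  simp only [hq, coeff_add, coeff_C_mul, coeff_X_pow, coeff_X, coeff_C, coeff_zero] at h0 h1 h2
  norm_num at h0 h1 h2
  exact ⟨h0, h1, h2⟩

/-- **The members of `𝒜^(K)` are distinct ideals** (p. 10: "if `η` is small enough, no two values of
`x + y·2^{1/3}` are associates, so that `𝒜^(K)` contains distinct ideals"); in fact for all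
`X ≥ 1` and `η ≤ 1`. Proof: if `(x' + y'θ) = (x + yθ)` then `x' + y'θ = (a + bθ + cθ²)(x + yθ)`
with `a, b, c ∈ ℤ` (`𝓞_K = ℤ[θ]`); comparing coordinates, `by + cx = 0`, so `b = kx`, `c = −ky`
(`gcd(x, y) = 1`) and `x'y − y'x = −k(x³ + 2y³)`; but `|x'y − y'x| < 3X² ≤ 3X³ < x³ + 2y³`, so
`k = 0`, `(x', y') = a·(x, y)` and `a = 1` by coprimality. [cite: HeathBrownActa2001, §3 p. 10] -/
theorem pairIdeal_injOn {X η : ℝ} (hX : 1 ≤ X) (hη : η ≤ 1) :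
    Set.InjOn pairIdeal (boxPairs X η : Set (ℕ × ℕ)) := by
  rintro ⟨x, y⟩ hxy ⟨x', y'⟩ hxy' heq
  rw [mem_coe, mem_boxPairs_iff] at hxy hxy'
  obtain ⟨hx1, hx2, hy1, hy2, hcop⟩ := hxy
  obtain ⟨hx1', hx2', hy1', hy2', hcop'⟩ := hxy'
  dsimp only at hx1 hx2 hy1 hy2 hcop hx1' hx2' hy1' hy2' hcop'
  have hX0 : 0 < X := by linarith
  have hxpos : 0 < x := Nat.cast_pos.mp (hX0.trans hx1)
  have hx'pos : 0 < x' := Nat.cast_pos.mp (hX0.trans hx1')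
  -- `x' + y'θ = w (x + yθ)` with `w = a + bθ + cθ²`
  have hmem : pairElt (x', y') ∈ pairIdeal (x, y) := by rw [heq]; exact pairElt_mem_pairIdeal _
  obtain ⟨w, hw⟩ := Ideal.mem_span_singleton'.mp hmem
  obtain ⟨a, b, c, rfl⟩ := exists_int_coords w
  have hK := congr_arg (algebraMap (𝓞 K) K) hw
  simp only [pairElt, map_add, map_mul, map_pow, map_intCast, map_natCast,
    show algebraMap (𝓞 K) K θint = θ from rfl] at hK
  have hlin : ((a * x + 2 * c * y - x' : ℤ) : K) + ((a * y + b * x - y' : ℤ) : K) * θ +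
      ((b * y + c * x : ℤ) : K) * θ ^ 2 = 0 := by
    have hexp : ((a : K) + (b : K) * θ + (c : K) * θ ^ 2) * ((x : K) + (y : K) * θ) =
        (a * x : K) + (a * y + b * x) * θ + (b * y + c * x) * θ ^ 2 + c * y * θ ^ 3 := by ring
    rw [hexp, θ_pow_three] at hK
    push_cast
    linear_combination hK
  obtain ⟨e1, e2, e3⟩ := intCoords_eq_zero hlin
  -- integer bookkeeping
  have hcopZ : IsCoprime (x : ℤ) (y : ℤ) := Nat.isCoprime_iff_coprime.mpr hcop
  have hxb : (x : ℤ) ∣ b := hcopZ.dvd_of_dvd_mul_right ⟨-c, by linear_combination e3⟩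
  obtain ⟨k, hk⟩ := hxb
  have hx0 : (x : ℤ) ≠ 0 := by exact_mod_cast hxpos.ne'
  have hc : c = -(k * y) := by
    have h : (x : ℤ) * (k * y + c) = 0 := by rw [hk] at e3; linear_combination e3
    rcases mul_eq_zero.mp h with h | h
    · exact absurd h hx0
    · linarith
  have hdet : (x' : ℤ) * y - (y' : ℤ) * x = -k * ((x : ℤ) ^ 3 + 2 * (y : ℤ) ^ 3) := by
    have e1' : (x' : ℤ) = a * x + 2 * c * y := by linarith
    have e2' : (y' : ℤ) = a * y + b * x := by linarith
    rw [e1', e2', hk, hc]; ring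
  -- `|x'y − y'x| < x³ + 2y³`
  have hbnd : |(x' : ℝ) * y - (y' : ℝ) * x| < (x : ℝ) ^ 3 + 2 * (y : ℝ) ^ 3 := by
    have h2X : X * (1 + η) ≤ 2 * X := by nlinarith
    have h1 : (x' : ℝ) * y ≤ (2 * X) * (2 * X) :=
      mul_le_mul (hx2'.trans h2X) (hy2.trans h2X) (by positivity) (by positivity)
    have h2 : X * X < (x' : ℝ) * y := mul_lt_mul'' hx1' hy1 hX0.le hX0.le
    have h3 : (y' : ℝ) * x ≤ (2 * X) * (2 * X) :=
      mul_le_mul (hy2'.trans h2X) (hx2.trans h2X) (by positivity) (by positivity)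
    have h4 : X * X < (y' : ℝ) * x := mul_lt_mul'' hy1' hx1 hX0.le hX0.le
    have h5 : X ^ 3 < (x : ℝ) ^ 3 := pow_lt_pow_left₀ hx1 hX0.le three_ne_zero
    have h6 : X ^ 3 < (y : ℝ) ^ 3 := pow_lt_pow_left₀ hy1 hX0.le three_ne_zero
    have h7 : X ^ 2 ≤ X ^ 3 := pow_le_pow_right₀ hX (by norm_num)
    rw [abs_lt]
    constructor <;> nlinarith
  have hbndZ : |(x' : ℤ) * y - (y' : ℤ) * x| < (x : ℤ) ^ 3 + 2 * (y : ℤ) ^ 3 := by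
    exact_mod_cast hbnd
  -- hence `k = 0`
  have hk0 : k = 0 := by
    by_contra hk0
    have h1 : (1 : ℤ) ≤ |k| := Int.one_le_abs hk0
    have hN0 : (0 : ℤ) < (x : ℤ) ^ 3 + 2 * (y : ℤ) ^ 3 := by positivity
    have h2 : (x : ℤ) ^ 3 + 2 * (y : ℤ) ^ 3 ≤ |(x' : ℤ) * y - (y' : ℤ) * x| := by
      rw [hdet, abs_mul, abs_neg, abs_of_pos hN0]
      nlinarith
    linarith
  subst hk0
  have hb0 : b = 0 := by rw [hk]; ring
  have hc0 : c = 0 := by rw [hc]; ring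
  rw [hc0] at e1
  rw [hb0] at e2
  have e1' : (x' : ℤ) = a * x := by linarith
  have e2' : (y' : ℤ) = a * y := by linarith
  -- `a = 1`
  have hapos : 0 < a := by
    have h1 : (0 : ℤ) < x' := by exact_mod_cast hx'pos
    have h2 : (0 : ℤ) < x := by exact_mod_cast hxpos
    nlinarith
  have hdvd : a.natAbs ∣ Nat.gcd x' y' :=
    Nat.dvd_gcd (Int.natAbs_dvd_natAbs.mpr ⟨x, e1'⟩) (Int.natAbs_dvd_natAbs.mpr ⟨y, e2'⟩)
  rw [Nat.Coprime.gcd_eq_one hcop', Nat.dvd_one] at hdvd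
  have ha : a = 1 := by omega
  subst ha
  rw [one_mul] at e1' e2'
  exact Prod.ext (by exact_mod_cast e1'.symm) (by exact_mod_cast e2'.symm)

end Literature.NumberTheory.Sieve.CubicSieve

end
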